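import Literature.Analysis.FluidPDE.NSEnstrophyPersistenceForced
import Literature.Analysis.FluidPDE.TaoForcedUniquenessHolds
import Literature.Analysis.FluidPDE.AxisymQuotientRayAverage
import HarnessLib

/-!
# Tao 2013, Cor. 11.1 + Cor. 4.3 + Thm. 5.4 (iv) for an `H^∞` DATUM: every finite-energy classical
# Navier–Stokes solution on a closed slab from a datum with all Sobolev norms finite is in Tao's class
# (hence BOUNDED, with bounded gradient) — in particular every restart from a slice of a Tao-class flow

Analysis/FluidPDE proof file (cell `pub/ns-blowup`, seat `ns-blowup-ecbridge-7` g5; theorems only, no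
definition, no named fact, no `sorry`). LABEL: E–C analytic lane (KERNEL). WHAT THIS IS NOT: not a
statement about Navier–Stokes blow-up or regularity in the large — it is regularity BOOKKEEPING for a
GIVEN smooth finite-energy solution on a closed slab on which it is already assumed classical.

## What is proved, and why

The tree's theorem `IsClassicalNSSolutionOn.hasBoundedSobolevNormsOn_of_clayForce`
(`NSEnstrophyPersistenceForced.lean`, seat lit g10) puts every classical finite-energy solution of the
forced system on `[0, T] × ℝ³` (`ν > 0`) in Tao's class `L^∞_t H^k_x` for all `k`
(`HasBoundedSobolevNormsOn (Icc 0 T) u`) when the datum is SCHWARTZ-class (`HasRapidSpatialDecay (u 0)`,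
Fefferman's (4)) and the force is Clay-class. Its proof, however, reads the datum only through
`∫ ‖Dᵐ u(0)‖² < ∞` for every `m` and the force only through `sup_t ∫ ‖Dᵐ f(t)‖² < ∞` for every `m`
(chain: Lemma 8.1 ⇒ finite dissipation `dissipation_lt_top_of_forceL2`; Prop. 9.1 ⇒ finite total speed
`totalSpeed_lt_top_of_forceL2`; Cor. 11.1 ⇒ `u ∈ X¹` `memSobolevX_one_forced_of_totalSpeed`; persistence
`hasBoundedSobolevNormsOn_forced_of_memSobolevX`). This file records the resulting `H^∞`-DATUM form
(`IsClassicalNSSolutionOn.hasBoundedSobolevNormsOn_of_sobolevDatum`), its unforced twin, the uniform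
bounds on the solution and all its derivatives that follow by Sobolev embedding
(`exists_norm_iteratedFDeriv_le_of_sobolevDatum`, `exists_norm_le_of_sobolevDatum`,
`exists_norm_fderiv_le_of_sobolevDatum`), and the RESTART form: a finite-energy classical solution whose
datum is a SLICE `v t₀` of a family `v` with bounded Sobolev norms (e.g. an earlier Tao-class solution) is
itself Tao-class on its whole closed slab (`hasBoundedSobolevNormsOn_of_restart`,
`exists_norm_le_of_restart`) — no decay of the slice at spatial infinity is needed (a Navier–Stokes slice
at a positive time is in general NOT rapidly decaying, so the Schwartz-datum theorem does not restart).

Consumer (cell `ns-blowup`, route `PalasekTowerBreakdown`, item stmt-NavierStokesRegularity-19249):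
free Navier–Stokes runs from a registered slice `s.u (τ k)` (the `SliceRun` schema of
`FluidComputer/PalasekTowerRegisterGlobalFloorsAtSlice.lean`) are Tao-class and BOUNDED, so the
boundedness clause of `Stage.exists_continuation_of_freeRun` is automatic and the upper stub
`AprioriCeilingAt k` has a hypothesis-free slice form (companion FluidComputer file).

## References

* T. Tao, *Localisation and compactness properties of the Navier–Stokes global regularity problem*,
  Anal. PDE 6 (2013) 25–107 = arXiv:1108.1165 (`Tao2011`): Cor. 11.1 (arXiv Cor. 68), Cor. 4.3 (arXiv
  Cor. 26), Thm. 5.4 (iv) (arXiv Thm. 31 (iv)), Prop. 9.1 (arXiv Prop. 52), Lemma 8.1 (arXiv Lemma 44).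
* R. A. Adams, J. J. F. Fournier, *Sobolev Spaces*, 2nd ed., Academic Press 2003, Thm. 4.12 (the
  embedding `H²(ℝ³) ⊂ C_B` behind the uniform bounds).
-/

noncomputable section

open MeasureTheory Set Filter Topology Function
open scoped ENNReal NNReal ContDiff

namespace Literature.Analysis.FluidPDE

section SobolevDatum

variable {T ν : ℝ} {f u : ℝ → EuclideanSpace ℝ (Fin 3) → EuclideanSpace ℝ (Fin 3)}
  {p : ℝ → EuclideanSpace ℝ (Fin 3) → ℝ}

/-- **Tao 2013, Cor. 11.1 + Cor. 4.3 + Thm. 5.4 (iv) WITH force — `H^∞`-datum form.** Let `ν > 0`,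
`T > 0`, and let `(u, p)` be a classical solution of the forced Navier–Stokes system on the CLOSED slab
`[0, T] × ℝ³` with finite energy `sup_{t ∈ [0,T]} ∫|u(t)|² < ∞`, whose datum has ALL Sobolev norms
finite (`∫ ‖Dᵐ u(0)‖² < ∞` for every `m`) and whose force has all Sobolev norms bounded on the slab
(`sup_{t ∈ [0,T]} ∫ ‖Dᵐ f(t)‖² < ∞` for every `m`). Then `u ∈ L^∞_t H^k_x([0,T] × ℝ³)` for every `k`
(`HasBoundedSobolevNormsOn (Icc 0 T) u`). Same chain as the tree's Schwartz-datum theorem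
`hasBoundedSobolevNormsOn_of_clayForce`, every link a theorem of the tree: Lemma 8.1 and Prop. 9.1 WITH
force (`dissipation_lt_top_of_forceL2`, `totalSpeed_lt_top_of_forceL2`), Cor. 11.1 WITH force
(`memSobolevX_one_forced_of_totalSpeed`), persistence of regularity WITH force
(`hasBoundedSobolevNormsOn_forced_of_memSobolevX`).
[cite: Tao2011, Cor. 11.1 + Cor. 4.3 + Thm. 5.4 (iv) (arXiv Cor. 68, Cor. 26, Thm. 31 (iv))] -/
theorem IsClassicalNSSolutionOn.hasBoundedSobolevNormsOn_of_sobolevDatum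
    (hsol : IsClassicalNSSolutionOn (Icc 0 T) ν f u p) (hν : 0 < ν) (hT : 0 < T)
    (hE : ∃ C : ℝ≥0, ∀ t ∈ Icc 0 T, ∫⁻ x, ‖u t x‖ₑ ^ 2 ≤ C)
    (h₀ : ∀ m : ℕ, ∫⁻ x, ‖iteratedFDeriv ℝ m (u 0) x‖ₑ ^ 2 < ⊤)
    (hf : ∀ m : ℕ, ∃ C : ℝ≥0, ∀ t ∈ Icc 0 T, ∫⁻ x, ‖iteratedFDeriv ℝ m (f t) x‖ₑ ^ 2 ≤ C) :
    HasBoundedSobolevNormsOn (Icc 0 T) u := by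
  -- the energy in the `ℝ≥0∞` rendering of the `L²`-force lemmas
  have hE' : ∃ A : ℝ≥0∞, A < ⊤ ∧ ∀ t ∈ Icc 0 T, ∫⁻ x, ‖u t x‖ₑ ^ 2 ≤ A := by
    obtain ⟨C, hC⟩ := hE
    exact ⟨C, ENNReal.coe_lt_top, hC⟩
  -- the `L²` slices of the force (`m = 0`)
  obtain ⟨C₀, hC₀⟩ := hf 0
  have hCf : ∀ t ∈ Icc 0 T, ∫⁻ x, ‖f t x‖ₑ ^ 2 ≤ (C₀ : ℝ≥0∞) := by
    intro t ht
    have h1 := hC₀ t ht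
    have h2 : ∀ x, ‖iteratedFDeriv ℝ 0 (f t) x‖ₑ = ‖f t x‖ₑ := fun x =>
      enorm_eq_iff_norm_eq.2 norm_iteratedFDeriv_zero
    simp_rw [h2] at h1
    exact h1
  -- Lemma 8.1 and Prop. 9.1 WITH force: finite dissipation, finite total speed
  have hD := hsol.dissipation_lt_top_of_forceL2 hν hT ENNReal.coe_ne_top hCf hE'
  have hM := hsol.totalSpeed_lt_top_of_forceL2 hν hT ENNReal.coe_ne_top hCf hE'
  -- Cor. 11.1 WITH force: `u ∈ X¹`
  have hX : FluidPDE.MemSobolevX 1 T u :=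
    hsol.memSobolevX_one_forced_of_totalSpeed hν hT (fun j _ => hf j) (h₀ 1) hE hD hM
  -- persistence of regularity WITH force: all orders
  exact hsol.hasBoundedSobolevNormsOn_forced_of_memSobolevX hν hT hX h₀ hf

/-- **Unforced twin.** A classical solution of the UNFORCED Navier–Stokes system (`ν > 0`) on the closed
slab `[0, T] × ℝ³` with finite energy and an `H^∞` datum (`∫ ‖Dᵐ u(0)‖² < ∞` for every `m`) lies in
`L^∞_t H^k_x([0,T] × ℝ³)` for every `k`.
[cite: Tao2011, Cor. 11.1 + Cor. 4.3 + Thm. 5.4 (iv) (arXiv Cor. 68, Cor. 26, Thm. 31 (iv))] -/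
theorem IsClassicalNSSolutionOn.hasBoundedSobolevNormsOn_of_sobolevDatum_unforced
    (hsol : IsClassicalNSSolutionOn (Icc 0 T) ν 0 u p) (hν : 0 < ν) (hT : 0 < T)
    (hE : ∃ C : ℝ≥0, ∀ t ∈ Icc 0 T, ∫⁻ x, ‖u t x‖ₑ ^ 2 ≤ C)
    (h₀ : ∀ m : ℕ, ∫⁻ x, ‖iteratedFDeriv ℝ m (u 0) x‖ₑ ^ 2 < ⊤) :
    HasBoundedSobolevNormsOn (Icc 0 T) u :=
  hsol.hasBoundedSobolevNormsOn_of_sobolevDatum hν hT hE h₀ fun m =>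
    ⟨0, fun t _ => by simp⟩

/-- **Every spatial derivative of the solution is bounded on the closed slab** (`H^∞` datum, force with
bounded Sobolev slices): for each `n` one finite constant bounds `‖Dⁿ u(t, x)‖` for all
`(t, x) ∈ [0, T] × ℝ³` (Tao's class and the Sobolev embedding `H²(ℝ³) ⊂ C_B` applied to `Dⁿ u(t)`).
[cite: Tao2011, Cor. 11.1 (arXiv Cor. 68)] [cite: AdamsFournier2003, Thm. 4.12 Part I Case A] -/
theorem IsClassicalNSSolutionOn.exists_norm_iteratedFDeriv_le_of_sobolevDatum
    (hsol : IsClassicalNSSolutionOn (Icc 0 T) ν f u p) (hν : 0 < ν) (hT : 0 < T)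
    (hE : ∃ C : ℝ≥0, ∀ t ∈ Icc 0 T, ∫⁻ x, ‖u t x‖ₑ ^ 2 ≤ C)
    (h₀ : ∀ m : ℕ, ∫⁻ x, ‖iteratedFDeriv ℝ m (u 0) x‖ₑ ^ 2 < ⊤)
    (hf : ∀ m : ℕ, ∃ C : ℝ≥0, ∀ t ∈ Icc 0 T, ∫⁻ x, ‖iteratedFDeriv ℝ m (f t) x‖ₑ ^ 2 ≤ C) (n : ℕ) :
    ∃ B : ℝ, 0 ≤ B ∧ ∀ t ∈ Icc 0 T, ∀ x, ‖iteratedFDeriv ℝ n (u t) x‖ ≤ B :=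
  (hsol.hasBoundedSobolevNormsOn_of_sobolevDatum hν hT hE h₀ hf).exists_forall_norm_iteratedFDeriv_le
    (fun _ ht => hsol.contDiff_velocity ht) n

/-- **The solution is BOUNDED on the closed slab** (`H^∞` datum, force with bounded Sobolev slices): one
finite constant bounds `‖u(t, x)‖` for all `(t, x) ∈ [0, T] × ℝ³`. A classical solution in the tree's
sense is smooth but not a priori bounded in space; with finite energy and an `H^∞` datum it is.
[cite: Tao2011, Cor. 11.1 (arXiv Cor. 68)] [cite: AdamsFournier2003, Thm. 4.12 Part I Case A] -/
theorem IsClassicalNSSolutionOn.exists_norm_le_of_sobolevDatum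
    (hsol : IsClassicalNSSolutionOn (Icc 0 T) ν f u p) (hν : 0 < ν) (hT : 0 < T)
    (hE : ∃ C : ℝ≥0, ∀ t ∈ Icc 0 T, ∫⁻ x, ‖u t x‖ₑ ^ 2 ≤ C)
    (h₀ : ∀ m : ℕ, ∫⁻ x, ‖iteratedFDeriv ℝ m (u 0) x‖ₑ ^ 2 < ⊤)
    (hf : ∀ m : ℕ, ∃ C : ℝ≥0, ∀ t ∈ Icc 0 T, ∫⁻ x, ‖iteratedFDeriv ℝ m (f t) x‖ₑ ^ 2 ≤ C) :
    ∃ B : ℝ, 0 ≤ B ∧ ∀ t ∈ Icc 0 T, ∀ x, ‖u t x‖ ≤ B := by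
  obtain ⟨B, hB0, hB⟩ := hsol.exists_norm_iteratedFDeriv_le_of_sobolevDatum hν hT hE h₀ hf 0
  exact ⟨B, hB0, fun t ht x => by simpa using hB t ht x⟩

/-- **The velocity gradient is bounded on the closed slab** (`H^∞` datum, force with bounded Sobolev
slices): one finite constant bounds the operator norm `‖Du(t, x)‖` for all `(t, x) ∈ [0, T] × ℝ³`.
[cite: Tao2011, Cor. 11.1 (arXiv Cor. 68)] [cite: AdamsFournier2003, Thm. 4.12 Part I Case A] -/
theorem IsClassicalNSSolutionOn.exists_norm_fderiv_le_of_sobolevDatum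
    (hsol : IsClassicalNSSolutionOn (Icc 0 T) ν f u p) (hν : 0 < ν) (hT : 0 < T)
    (hE : ∃ C : ℝ≥0, ∀ t ∈ Icc 0 T, ∫⁻ x, ‖u t x‖ₑ ^ 2 ≤ C)
    (h₀ : ∀ m : ℕ, ∫⁻ x, ‖iteratedFDeriv ℝ m (u 0) x‖ₑ ^ 2 < ⊤)
    (hf : ∀ m : ℕ, ∃ C : ℝ≥0, ∀ t ∈ Icc 0 T, ∫⁻ x, ‖iteratedFDeriv ℝ m (f t) x‖ₑ ^ 2 ≤ C) :
    ∃ B : ℝ, 0 ≤ B ∧ ∀ t ∈ Icc 0 T, ∀ x, ‖fderiv ℝ (u t) x‖ ≤ B := by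
  obtain ⟨B, hB0, hB⟩ := hsol.exists_norm_iteratedFDeriv_le_of_sobolevDatum hν hT hE h₀ hf 1
  refine ⟨B, hB0, fun t ht x => ?_⟩
  have h1 := hB t ht x
  rwa [← norm_iteratedFDeriv_fderiv (n := 0), norm_iteratedFDeriv_zero] at h1

/-- **Unforced twin of the sup bound**: an unforced classical finite-energy solution on `[0, T] × ℝ³`
(`ν > 0`) from an `H^∞` datum is bounded there, with a bounded gradient.
[cite: Tao2011, Cor. 11.1 (arXiv Cor. 68)] [cite: AdamsFournier2003, Thm. 4.12 Part I Case A] -/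
theorem IsClassicalNSSolutionOn.exists_norm_le_of_sobolevDatum_unforced
    (hsol : IsClassicalNSSolutionOn (Icc 0 T) ν 0 u p) (hν : 0 < ν) (hT : 0 < T)
    (hE : ∃ C : ℝ≥0, ∀ t ∈ Icc 0 T, ∫⁻ x, ‖u t x‖ₑ ^ 2 ≤ C)
    (h₀ : ∀ m : ℕ, ∫⁻ x, ‖iteratedFDeriv ℝ m (u 0) x‖ₑ ^ 2 < ⊤) :
    (∃ B : ℝ, 0 ≤ B ∧ ∀ t ∈ Icc 0 T, ∀ x, ‖u t x‖ ≤ B) ∧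
      ∃ B : ℝ, 0 ≤ B ∧ ∀ t ∈ Icc 0 T, ∀ x, ‖fderiv ℝ (u t) x‖ ≤ B := by
  have hf : ∀ m : ℕ, ∃ C : ℝ≥0, ∀ t ∈ Icc 0 T,
      ∫⁻ x, ‖iteratedFDeriv ℝ m ((0 : ℝ → EuclideanSpace ℝ (Fin 3) → EuclideanSpace ℝ (Fin 3)) t) x‖ₑ ^ 2
        ≤ C := fun m =>
    ⟨0, fun t _ => by simp⟩
  exact ⟨hsol.exists_norm_le_of_sobolevDatum hν hT hE h₀ hf,
    hsol.exists_norm_fderiv_le_of_sobolevDatum hν hT hE h₀ hf⟩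

end SobolevDatum

/-! ## Restart from a slice of a family with bounded Sobolev norms -/

section Restart

variable {T ν : ℝ} {f u : ℝ → EuclideanSpace ℝ (Fin 3) → EuclideanSpace ℝ (Fin 3)}
  {p : ℝ → EuclideanSpace ℝ (Fin 3) → ℝ}

/-- A slice of a family with bounded Sobolev norms on `S` (taken at a time of `S`) has all its Sobolev
norms finite — it is an admissible `H^∞` datum. [folklore] -/
private theorem HasBoundedSobolevNormsOn.lintegral_iteratedFDeriv_slice_lt_top {S : Set ℝ}
    {v : ℝ → EuclideanSpace ℝ (Fin 3) → EuclideanSpace ℝ (Fin 3)} (hv : HasBoundedSobolevNormsOn S v)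
    {t₀ : ℝ} (ht₀ : t₀ ∈ S) (m : ℕ) : ∫⁻ x, ‖iteratedFDeriv ℝ m (v t₀) x‖ₑ ^ 2 < ⊤ := by
  obtain ⟨C, hC⟩ := hv m
  exact (hC t₀ ht₀).trans_lt ENNReal.coe_lt_top

/-- **RESTART: a finite-energy classical solution from a SLICE of a Tao-class family is Tao-class on its
whole closed slab.** Let `v` have bounded Sobolev norms of all orders on a time set `S` (for instance an
earlier classical finite-energy solution from a Schwartz datum, by `hasBoundedSobolevNormsOn_of_clayForce`),
`t₀ ∈ S`, and let `(u, p)` be a classical solution on `[0, T] × ℝ³` (`ν > 0`, force with bounded Sobolev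
slices) with finite energy and datum `u 0 = v t₀`. Then `u ∈ L^∞_t H^k_x([0, T] × ℝ³)` for every `k`. No
spatial decay of the slice is required.
[cite: Tao2011, Cor. 11.1 + Cor. 4.3 + Thm. 5.4 (iv) (arXiv Cor. 68, Cor. 26, Thm. 31 (iv))] -/
theorem IsClassicalNSSolutionOn.hasBoundedSobolevNormsOn_of_restart {S : Set ℝ}
    {v : ℝ → EuclideanSpace ℝ (Fin 3) → EuclideanSpace ℝ (Fin 3)} (hv : HasBoundedSobolevNormsOn S v)
    {t₀ : ℝ} (ht₀ : t₀ ∈ S)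
    (hsol : IsClassicalNSSolutionOn (Icc 0 T) ν f u p) (hν : 0 < ν) (hT : 0 < T)
    (hE : ∃ C : ℝ≥0, ∀ t ∈ Icc 0 T, ∫⁻ x, ‖u t x‖ₑ ^ 2 ≤ C) (hu₀ : u 0 = v t₀)
    (hf : ∀ m : ℕ, ∃ C : ℝ≥0, ∀ t ∈ Icc 0 T, ∫⁻ x, ‖iteratedFDeriv ℝ m (f t) x‖ₑ ^ 2 ≤ C) :
    HasBoundedSobolevNormsOn (Icc 0 T) u :=
  hsol.hasBoundedSobolevNormsOn_of_sobolevDatum hν hT hE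
    (fun m => by rw [hu₀]; exact hv.lintegral_iteratedFDeriv_slice_lt_top ht₀ m) hf

/-- **RESTART, unforced, with the bounds spelled out**: an UNFORCED classical finite-energy solution on
`[0, T] × ℝ³` (`ν > 0`) started from a slice `v t₀` of a family with bounded Sobolev norms is Tao-class
on `[0, T]`, BOUNDED there, and has a bounded gradient there.
[cite: Tao2011, Cor. 11.1 (arXiv Cor. 68)] [cite: AdamsFournier2003, Thm. 4.12 Part I Case A] -/
theorem IsClassicalNSSolutionOn.exists_norm_le_of_restart_unforced {S : Set ℝ}
    {v : ℝ → EuclideanSpace ℝ (Fin 3) → EuclideanSpace ℝ (Fin 3)} (hv : HasBoundedSobolevNormsOn S v)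
    {t₀ : ℝ} (ht₀ : t₀ ∈ S)
    (hsol : IsClassicalNSSolutionOn (Icc 0 T) ν 0 u p) (hν : 0 < ν) (hT : 0 < T)
    (hE : ∃ C : ℝ≥0, ∀ t ∈ Icc 0 T, ∫⁻ x, ‖u t x‖ₑ ^ 2 ≤ C) (hu₀ : u 0 = v t₀) :
    HasBoundedSobolevNormsOn (Icc 0 T) u ∧
      (∃ B : ℝ, 0 ≤ B ∧ ∀ t ∈ Icc 0 T, ∀ x, ‖u t x‖ ≤ B) ∧
      ∃ B : ℝ, 0 ≤ B ∧ ∀ t ∈ Icc 0 T, ∀ x, ‖fderiv ℝ (u t) x‖ ≤ B := by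
  have h₀ : ∀ m : ℕ, ∫⁻ x, ‖iteratedFDeriv ℝ m (u 0) x‖ₑ ^ 2 < ⊤ := fun m => by
    rw [hu₀]; exact hv.lintegral_iteratedFDeriv_slice_lt_top ht₀ m
  exact ⟨hsol.hasBoundedSobolevNormsOn_of_sobolevDatum_unforced hν hT hE h₀,
    hsol.exists_norm_le_of_sobolevDatum_unforced hν hT hE h₀⟩

end Restart

end Literature.Analysis.FluidPDE

end
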